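import Literature.Topology.FourManifolds.SphereSurgerySignature
import Literature.Topology.FourManifolds.LatticeFormsCodimOneSignature
import Literature.Topology.FourManifolds.HomotopySpheresBPOrderSignatureUnimodular
import Literature.AlgebraicTopology.SingularHomology.IntersectionFormProofs
import Literature.AlgebraicTopology.SingularHomology.LefschetzDualityProofs
import Literature.AlgebraicTopology.SingularHomology.EulerCharacteristicTriple
import Literature.AlgebraicTopology.SingularHomology.CohomologyClopenPieces
import Literature.AlgebraicTopology.SingularHomology.CupProductProofs
import HarnessLib

/-!
# The signature is not changed by a surgery on a `(p-1)`-sphere in a `2p`-manifold bounded by a homotopy sphere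

Topic `Literature/Topology/FourManifolds` (fact seat of
`Literature.Topology.FourManifolds.HomotopySphere.exists_highlyConnected_of_mem_signatureSet`,
brick B6h: the last index of the `σ`-invariance input `h6` of `SurgeryBelowMiddleDimension.lean`).
A. Kosinski, *Differential Manifolds* (1993), Ch. X §3, Prop. (3.3), p. 206 ("`σ(M)` is an
invariant of cobordism"); M. Kervaire, J. Milnor, *Groups of homotopy spheres I*, Ann. of Math.
77 (1963), §5 (Lemma 5.6) and §7 footnote pp. 528–529.  For a surgery on `Sᵖ⁻¹ × Dᵖ⁺¹ ⊂ W²ᵖ`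
the two ends of the closed models have cohomology in the critical degrees —
`Hᵖ⁻¹(T̂) ≅ Hᵖ⁻¹(Sᵖ⁻¹) ≅ ℤ`, `Hᵖ(T̂') ≅ Hᵖ(Sᵖ) ≅ ℤ` — so that in the chain of
`SphereSurgerySignature.lean`

  `Hᵖ(Ŵ) ↞ Hᵖ(Ŵ, Ŵ ∖ ι_X K₀) ≅ Hᵖ(Z, Z ∖ K₀) ≅ Hᵖ(χ̂, χ̂ ∖ ι_P K₀) ↪ Hᵖ(χ̂)`

the left map has a kernel of rank `ε ≤ 1` and the right one a cokernel of rank `ρ ≤ 1`.  The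
index is still unchanged: `ε = ρ` by the rank symmetry `rank Hᵖ⁻¹ = rank Hᵖ⁺¹` of the two closed
models (Lefschetz duality on `(W, bW)`, `bW` a homology sphere — no duality on the closed models
themselves is used) and rank bookkeeping along the two exact sequences; if `ρ = 0` the image has
finite index (`signature_eq_of_comp_of_finiteIndex`), and if `ρ = 1` a non-torsion kernel vector
`s` is a radical vector of the common pulled-back form pairing non-trivially with any new class `t`
(unimodularity modulo torsion of the new closed model, `isUnimodular_intersectionForm_closedModel`),
so `signature_eq_of_isotropic_radical` applies.

* `HomotopySphere.finrank_singularCohomology_closedModel_symm` — `rank Hᵖ(Ŵ; ℤ) = rank Hᵖ⁺²(Ŵ; ℤ)`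
  for the closed model of a null-cobordism of a homotopy sphere of dimension `2p + 1`, `2 ≤ p`;
* `LinearMap.BilinForm.signature_compl₁₂_eq_of_corank_le_one` — the algebraic dispatcher
  (finite index or isotropic radical vector);
* `NullCobordism.signatureInDim_surgery_eq_of_eq` — **the case `k + 1 = p` of the invariance of
  the signature under surgery** (boundary a homotopy sphere, `4 ≤ p` even).

Everything is proved; no definitions, no named facts.

## References

* A. Kosinski, *Differential Manifolds* (1993), Ch. X §3, Prop. (3.3), p. 206. [Kosinski1993]
* M. Kervaire, J. Milnor, *Groups of homotopy spheres I*, Ann. of Math. 77 (1963), §5 Lemma 5.6,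
  §7 p. 528 and footnote pp. 528–529. [KervaireMilnorAnnals1963]
* A. Hatcher, *Algebraic Topology* (2002), Thm. 3.43, Prop. 2.22, Cor. 2.14, Thm. 3.2, Cor. 3.3,
  §3.1 p. 200, Thm. 3.11. [HatcherAT2002]
* J.-P. Serre, *A Course in Arithmetic* (1973), Ch. IV §1.3–§1.4, Ch. V §1.3.2. [Serre1973]
-/

noncomputable section

open scoped Manifold ContDiff Topology
open Set Function Filter CategoryTheory Limits Topology Metric
open Literature.AlgebraicTopology.SingularHomology

/-! ### §0 The algebraic dispatcher: finite index, or an isotropic radical vector -/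

namespace LinearMap.BilinForm

open Literature.Topology.FourManifolds

/-- **The index of a form pulled back along an injection `f` of corank `≤ 1`, given a second
pull-back presentation through a surjection `g` with `BX (g a) (g b) = BP (f a) (f b)` and
non-degeneracy of `BP` modulo torsion.**  The numerical hypotheses say
`rank coker f = rank ker g ≤ 1`.  Either `range f` has finite index in `HP` (then
`signature_eq_of_comp_of_finiteIndex`), or a class `t` generates `HP / range f` modulo torsion
and a non-torsion `s` with `g s = 0` is a radical vector of the pulled-back form with
`BP (f s) t ≠ 0` (non-degeneracy), so `signature_eq_of_isotropic_radical` applies.  Serre,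
*A Course in Arithmetic* (1973), Ch. IV §1.3–§1.4 (hyperbolic planes, orthogonal splitting).
[cite: Serre1973, Ch. IV §1.3–§1.4] [cite: KervaireMilnorAnnals1963, §7, footnote pp. 528–529] -/
theorem signature_compl₁₂_eq_of_corank_le_one {FZ HX HP : Type} [AddCommGroup FZ]
    [instFZ : Module ℤ FZ] [AddCommGroup HX] [instHX : Module ℤ HX] [AddCommGroup HP]
    [instHP : Module ℤ HP] [Module.Finite ℤ HP]
    (BX : LinearMap.BilinForm ℤ HX) (BP : LinearMap.BilinForm ℤ HP) (hBP : BP.IsSymm)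
    (g : FZ →ₗ[ℤ] HX) (hg : Function.Surjective g) (f : FZ →ₗ[ℤ] HP) (hf : Function.Injective f)
    (hagree : ∀ a b, BX (g a) (g b) = BP (f a) (f b))
    (hnd : ∀ u : HP, (∀ v, BP u v = 0) → ∃ n : ℤ, n ≠ 0 ∧ n • u = 0)
    (h1 : Module.finrank ℤ HP + Module.finrank ℤ HX = Module.finrank ℤ FZ + Module.finrank ℤ FZ)
    (h2 : Module.finrank ℤ FZ ≤ Module.finrank ℤ HX + 1) :
    signature (BP.compl₁₂ f f) = signature BP := by
  obtain rfl : instFZ = AddCommGroup.toIntModule FZ := Subsingleton.elim _ _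
  obtain rfl : instHX = AddCommGroup.toIntModule HX := Subsingleton.elim _ _
  obtain rfl : instHP = AddCommGroup.toIntModule HP := Subsingleton.elim _ _
  haveI : Module.Finite ℤ FZ := Module.Finite.of_injective f hf
  haveI : Module.Finite ℤ HX := Module.Finite.of_surjective g hg
  by_cases hFI : ∀ v : HP, ∃ n : ℤ, n ≠ 0 ∧ n • v ∈ LinearMap.range f
  · exact signature_eq_of_comp_of_finiteIndex (BP.compl₁₂ f f) BP f (fun x y => rfl) hFI
  push Not at hFI
  obtain ⟨t, ht⟩ := hFI
  -- the quotient `Q = HP / range f` and its projection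
  set N : Submodule ℤ HP := LinearMap.range f with hN
  haveI hQfin : Module.Finite ℤ (HP ⧸ N) := Module.Finite.of_surjective N.mkQ N.mkQ_surjective
  have hmemN : ∀ x : HP, x ∈ N ↔ N.mkQ x = 0 := fun x => by
    rw [← LinearMap.mem_ker, Submodule.ker_mkQ]
  have hrN : Module.finrank ℤ N = Module.finrank ℤ FZ :=
    (LinearEquiv.finrank_eq (LinearEquiv.ofInjective f hf)).symm
  -- `range f` has corank exactly one
  have hq : Module.finrank ℤ (HP ⧸ N) + Module.finrank ℤ N = Module.finrank ℤ HP :=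
    Submodule.finrank_quotient_add_finrank N
  have hQne : Module.finrank ℤ (HP ⧸ N) ≠ 0 := by
    intro h0
    obtain ⟨a, ha, hat⟩ := (Module.finrank_eq_zero_iff.1 h0) (N.mkQ t)
    refine ht a ha ((hmemN _).2 ?_)
    rw [map_smul]; exact hat
  have hQ1 : Module.finrank ℤ (HP ⧸ N) = 1 := by omega
  -- a non-torsion `s` with `g s = 0`
  obtain ⟨s, hs0, hsnt⟩ : ∃ s, g s = 0 ∧ ∀ a : ℤ, a ≠ 0 → a • s ≠ 0 := by
    have hrk : Module.finrank ℤ (FZ ⧸ LinearMap.ker g) + Module.finrank ℤ (LinearMap.ker g) =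
        Module.finrank ℤ FZ := Submodule.finrank_quotient_add_finrank _
    have hrg : Module.finrank ℤ (FZ ⧸ LinearMap.ker g) = Module.finrank ℤ HX :=
      (LinearEquiv.finrank_eq g.quotKerEquivRange).trans
        (by rw [LinearMap.range_eq_top.2 hg, finrank_top])
    haveI : Module.Finite ℤ (LinearMap.ker g) :=
      Module.Finite.iff_fg.2 (IsNoetherian.noetherian (LinearMap.ker g))
    have hpos : Module.finrank ℤ (LinearMap.ker g) ≠ 0 := by omega
    rw [Ne, Module.finrank_eq_zero_iff] at hpos
    push Not at hpos
    obtain ⟨x, hx⟩ := hpos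
    exact ⟨x, LinearMap.mem_ker.1 x.2, fun a ha h0 => hx a ha (Subtype.ext (by simpa using h0))⟩
  -- `range f + ℤ t` has finite index
  have hfi' : ∀ v : HP, ∃ n : ℤ, n ≠ 0 ∧ ∃ (x : FZ) (a : ℤ), n • v = f x + a • t := by
    intro v
    set L : Submodule ℤ (HP ⧸ N) := Submodule.span ℤ {N.mkQ t} with hL
    haveI hLfin : Module.Finite ℤ L := Module.Finite.iff_fg.2 (IsNoetherian.noetherian L)
    haveI hQLfin : Module.Finite ℤ ((HP ⧸ N) ⧸ L) :=
      Module.Finite.of_surjective L.mkQ L.mkQ_surjective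
    have hL1 : 1 ≤ Module.finrank ℤ L := by
      rw [Nat.one_le_iff_ne_zero, Ne, Module.finrank_eq_zero_iff]
      intro hall
      obtain ⟨a, ha, hat⟩ := hall ⟨N.mkQ t, Submodule.mem_span_singleton_self _⟩
      refine ht a ha ((hmemN _).2 ?_)
      have hat' : a • N.mkQ t = 0 := by simpa using congrArg Subtype.val hat
      rw [map_smul]; exact hat'
    have hL2 : Module.finrank ℤ L ≤ Module.finrank ℤ (HP ⧸ N) := Submodule.finrank_le L
    have hq2 : Module.finrank ℤ ((HP ⧸ N) ⧸ L) + Module.finrank ℤ L =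
        Module.finrank ℤ (HP ⧸ N) := Submodule.finrank_quotient_add_finrank L
    have hQL : Module.finrank ℤ ((HP ⧸ N) ⧸ L) = 0 := by omega
    obtain ⟨n, hn, hnv⟩ := (Module.finrank_eq_zero_iff.1 hQL) (L.mkQ (N.mkQ v))
    have hnL : n • N.mkQ v ∈ L := by
      rw [← Submodule.ker_mkQ L, LinearMap.mem_ker, map_smul]; exact hnv
    obtain ⟨a, ha⟩ := Submodule.mem_span_singleton.1 hnL
    have hmem : n • v - a • t ∈ N := by
      rw [hmemN, map_sub, map_smul, map_smul, ha, sub_self]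
    obtain ⟨x, hx⟩ := LinearMap.mem_range.1 hmem
    exact ⟨n, hn, x, a, by rw [hx]; abel⟩
  -- `s` is a radical vector of the pulled-back form
  have hs : ∀ x, (BP.compl₁₂ f f) s x = 0 := fun x => by
    change BP (f s) (f x) = 0
    rw [← hagree, hs0, LinearMap.map_zero₂]
  -- and pairs non-trivially with `t`
  have hst : BP (f s) t ≠ 0 := by
    intro h0
    have hall : ∀ v, BP (f s) v = 0 := by
      intro v
      obtain ⟨n, hn, x, a, hv⟩ := hfi' v
      have h1 : BP (f s) (n • v) = 0 := by
        rw [hv, map_add, map_smul, ← hagree, hs0, LinearMap.map_zero₂, h0, smul_zero, add_zero]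
      rw [map_smul] at h1
      exact (smul_eq_zero.1 h1).resolve_left hn
    obtain ⟨n, hn, hns⟩ := hnd (f s) hall
    refine hsnt n hn (hf ?_)
    rw [map_smul, hns, map_zero]
  exact signature_eq_of_isotropic_radical (BP.compl₁₂ f f) BP hBP f (fun x y => rfl) s hs t hst hfi'

end LinearMap.BilinForm

namespace Literature.Topology.FourManifolds

/-! ### §1 Rank symmetry of the closed model about the middle degree -/

namespace HomotopySphere

variable {n : ℕ}

/-- `rank` is invariant under isomorphisms of `ℤ`-modules in `ModuleCat`. [folklore] -/
theorem finrank_eq_of_isIso {A B : ModuleCat.{0} ℤ} (f : A ⟶ B) [IsIso f] :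
    Module.finrank ℤ A = Module.finrank ℤ B :=
  LinearEquiv.finrank_eq (asIso f).toLinearEquiv

/-- **Rank symmetry of the closed model**: for a null-cobordism `c` of a homotopy
`(n+1)`-sphere (`M = c.W` of dimension `n + 2 = (p + 1) + (p + 1)`, `2 ≤ p`), the closed homology
manifold `M̂ = M ∪ cone(bM)` has `rank Hᵖ(M̂; ℤ) = rank Hᵖ⁺²(M̂; ℤ)` — from Lefschetz duality
`Hᵖ(M) ≅ Hₚ₊₂(M, bM)` (Spanier 6.3.12 / Hatcher 3.43, tree theorem), the collapse isomorphisms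
`Hⱼ(M) ≅ Hⱼ(M̂)` (`isIso_singularHomologyMap_boundaryCollapse`, Prop. 2.22), `Hⱼ(M) ≅ Hⱼ(M, bM)`
(`bM` a homology sphere) and `rank Hʲ = rank Hⱼ` (Thm. 3.2, Cor. 3.3). Kervaire–Milnor 1963 p. 528
("using the Poincaré duality theorem") with the footnote pp. 528–529.
[cite: KervaireMilnorAnnals1963, §7, p. 528 and footnote pp. 528–529] [cite: HatcherAT2002, Thm. 3.43, Prop. 2.22, Thm. 3.2] -/
theorem finrank_singularCohomology_closedModel_symm (S : HomotopySphere (n + 1))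
    (c : NullCobordism (n + 1) S.carrier) {μ : HomologicalOrientation ℤ S.carrier (n + 1)}
    {μ' : HomologicalOrientation ℤ (ClosedModel (n + 1) c.W) (n + 1 + 1)}
    (hor : c.IsOrientedBy μ μ') {p : ℕ} (hp : 2 ≤ p) (hpp : p + 1 + (p + 1) = n + 1 + 1) :
    Module.finrank ℤ (singularCohomology ℤ ℤ (ClosedModel (n + 1) c.W) p) =
      Module.finrank ℤ (singularCohomology ℤ ℤ (ClosedModel (n + 1) c.W) (p + 2)) := by
  haveI : Nonempty S.carrier := S.nonempty
  haveI : ConnectedSpace S.carrier := S.connectedSpace (Nat.succ_ne_zero n)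
  obtain ⟨κ⟩ := BoundaryData.nonempty_collar_of_compactSpace n c.W c.boundaryData
  -- finiteness
  haveI hWfin : ∀ j, Module.Finite ℤ (singularHomology ℤ ℤ c.W j) := fun j =>
    finite_singularHomology_of_compact_chartedSpace_halfSpace (n := n + 1) ℤ ℤ j
  haveI hXfin : ∀ j, Module.Finite ℤ (singularHomology ℤ ℤ (ClosedModel (n + 1) c.W) j) :=
    fun j => c.finite_singularHomology_closedModel κ j
  -- (1) `rank Hʲ(M̂) = rank Hⱼ(M̂)` for `j = p, p + 2`
  have u1 : Module.finrank ℤ (singularCohomology ℤ ℤ (ClosedModel (n + 1) c.W) p) =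
      Module.finrank ℤ (singularHomology ℤ ℤ (ClosedModel (n + 1) c.W) p) :=
    finrank_singularCohomology_eq_finrank_singularHomology (R := ℤ) (X := ClosedModel (n + 1) c.W) p
      fun j _ => hXfin j
  have u2 : Module.finrank ℤ (singularCohomology ℤ ℤ (ClosedModel (n + 1) c.W) (p + 2)) =
      Module.finrank ℤ (singularHomology ℤ ℤ (ClosedModel (n + 1) c.W) (p + 2)) :=
    finrank_singularCohomology_eq_finrank_singularHomology (R := ℤ) (X := ClosedModel (n + 1) c.W) (p + 2)
      fun j _ => hXfin j
  -- (2) `q_* : Hⱼ(M) ≅ Hⱼ(M̂)` for `j = p, p + 2`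
  obtain ⟨p2, hp2⟩ : ∃ p2, p = p2 + 1 := ⟨p - 1, by omega⟩
  haveI q1 := S.isIso_singularHomologyMap_boundaryCollapse c p2 (by omega) (by omega) (by omega)
  haveI q2 := S.isIso_singularHomologyMap_boundaryCollapse c (p + 1) (by omega) (by omega) (by omega)
  have v1 : Module.finrank ℤ (singularHomology ℤ ℤ c.W p) =
      Module.finrank ℤ (singularHomology ℤ ℤ (ClosedModel (n + 1) c.W) p) := by
    rw [hp2]; exact finrank_eq_of_isIso (singularHomology.map ℤ ℤ (boundaryCollapse (n + 1) c.W) (p2 + 1))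
  have v2 : Module.finrank ℤ (singularHomology ℤ ℤ c.W (p + 2)) =
      Module.finrank ℤ (singularHomology ℤ ℤ (ClosedModel (n + 1) c.W) (p + 2)) :=
    finrank_eq_of_isIso (singularHomology.map ℤ ℤ (boundaryCollapse (n + 1) c.W) (p + 1 + 1))
  -- (3) `Hₚ₊₂(M) ≅ Hₚ₊₂(M, bM)` (`bM` a homology sphere)
  have hB : ∀ j, j ≠ 0 → j ≠ n + 1 →
      IsZero (singularHomology ℤ ℤ ↥((𝓡∂ (n + 1 + 1)).boundary c.W) j) :=
    fun j hj hjn => S.isZero_singularHomology_boundary c hj hjn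
  haveI i3 : IsIso (relativeSingularHomology.ofAbsolute ℤ ℤ c.W ((𝓡∂ (n + 1 + 1)).boundary c.W)
      (p + 1 + 1)) :=
    isIso_ofAbsolute_of_isZero ℤ ℤ _ (p + 1) (hB _ (by omega) (by omega)) (hB _ (by omega) (by omega))
  have v3 : Module.finrank ℤ (singularHomology ℤ ℤ c.W (p + 2)) =
      Module.finrank ℤ (relativeSingularHomology ℤ ℤ c.W ((𝓡∂ (n + 1 + 1)).boundary c.W)
        (p + 2)) :=
    finrank_eq_of_isIso (relativeSingularHomology.ofAbsolute ℤ ℤ c.W ((𝓡∂ (n + 1 + 1)).boundary c.W) (p + 1 + 1))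
  -- (4) Lefschetz duality `Hᵖ(M) ≅ Hₚ₊₂(M, bM)`
  obtain ⟨w, hw, -, -⟩ := NullCobordism.IsOrientedBy.exists_isRelFundamentalClass c (by omega) hor
  have hL := bijective_relCapProduct_of_isRelFundamentalClass_holds (R := ℤ) (n + 1) c.W w hw
    (p := p) (q := p + 2) (by omega)
  let L : singularCohomology ℤ ℤ c.W p →+
      relativeSingularHomology ℤ ℤ c.W ((𝓡∂ (n + 1 + 1)).boundary c.W) (p + 2) :=
    { toFun := fun a => relCapProduct (M := ℤ) ((𝓡∂ (n + 1 + 1)).boundary c.W)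
        (show p + (p + 2) = n + 1 + 1 by omega) a w
      map_zero' := by rw [map_zero, LinearMap.zero_apply]
      map_add' := fun a b => by rw [map_add, LinearMap.add_apply] }
  let e := AddEquiv.ofBijective L hL
  have v4 : Module.finrank ℤ (singularCohomology ℤ ℤ c.W p) =
      Module.finrank ℤ (relativeSingularHomology ℤ ℤ c.W ((𝓡∂ (n + 1 + 1)).boundary c.W)
        (p + 2)) :=
    LinearEquiv.finrank_eq (e.toIntLinearEquiv (modM := ModuleCat.isModule _)
      (modM₂ := ModuleCat.isModule _))
  -- (5) `rank Hᵖ(M) = rank Hₚ(M)`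
  have u3 : Module.finrank ℤ (singularCohomology ℤ ℤ c.W p) =
      Module.finrank ℤ (singularHomology ℤ ℤ c.W p) :=
    finrank_singularCohomology_eq_finrank_singularHomology (R := ℤ) (X := c.W) p fun j _ => hWfin j
  omega

end HomotopySphere

/-! ### §2 The critical cohomology of the ends has rank one -/

section Ends

/-- Transport of "`rank = 1` and finitely generated" along an isomorphism in `ModuleCat ℤ`.
[folklore] -/
theorem finrank_eq_one_and_finite_of_iso {A B : ModuleCat.{0} ℤ} (e : A ≅ B)
    (h : Module.finrank ℤ B = 1 ∧ Module.Finite ℤ B) :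
    Module.finrank ℤ A = 1 ∧ Module.Finite ℤ A := by
  haveI := h.2
  exact ⟨(LinearEquiv.finrank_eq e.toLinearEquiv).trans h.1, Module.Finite.equiv e.toLinearEquiv.symm⟩

/-- **`Hᴺ(Sᴺ; ℤ) ≅ ℤ`** in the form "rank one and finitely generated", `2 ≤ N` (Hatcher 2002,
Cor. 2.14 with the universal coefficient theorem, Thm. 3.2 / Cor. 3.3).
[cite: HatcherAT2002, Cor. 2.14, Thm. 3.2 and Cor. 3.3] -/
theorem finrank_singularCohomology_sphere_top {N : ℕ} (hN : 2 ≤ N) :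
    Module.finrank ℤ (singularCohomology ℤ ℤ (Metric.sphere (0 : EuclideanSpace ℝ (Fin (N + 1))) 1) N) = 1 ∧
      Module.Finite ℤ (singularCohomology ℤ ℤ (Metric.sphere (0 : EuclideanSpace ℝ (Fin (N + 1))) 1) N) := by
  obtain ⟨e⟩ := nonempty_singularHomology_sphere_iso_holds (R := ℤ) (M := ℤ) (n := N) (by omega)
  let e' : singularHomology ℤ ℤ (Metric.sphere (0 : EuclideanSpace ℝ (Fin (N + 1))) 1) N ≃ₗ[ℤ] ℤ :=
    e.toLinearEquiv.trans (ULift.moduleEquiv (R := ℤ))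
  haveI : Module.Finite ℤ (singularHomology ℤ ℤ (Metric.sphere (0 : EuclideanSpace ℝ (Fin (N + 1))) 1) N) := Module.Finite.equiv e'.symm
  have hfin : ∀ j, j + 1 = N → Module.Finite ℤ (singularHomology ℤ ℤ (Metric.sphere (0 : EuclideanSpace ℝ (Fin (N + 1))) 1) j) := fun j hj =>
    finite_of_isZero (isZero_singularHomology_sphere_holds (R := ℤ) (M := ℤ) (n := N) (k := j)
      (by omega) (by omega))
  refine ⟨?_, finite_singularCohomology_of_finite_singularHomology N hfin⟩
  rw [finrank_singularCohomology_eq_finrank_singularHomology (R := ℤ) (X := Metric.sphere (0 : EuclideanSpace ℝ (Fin (N + 1))) 1) N hfin,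
    e'.finrank_eq, Module.finrank_self]

/-- Transport along `Y ≃ₜ Y' ≃ₕ Sᴺ`: `rank Hᴺ(Y; ℤ) = 1` and `Hᴺ(Y; ℤ)` is finitely generated.
[cite: HatcherAT2002, Cor. 2.11 and Cor. 2.14] -/
theorem finrank_singularCohomology_of_homeomorph_homotopyEquiv_sphere_top {Y Y' : Type}
    [TopologicalSpace Y] [TopologicalSpace Y'] (e : Y ≃ₜ Y')
    {N : ℕ} (h : ContinuousMap.HomotopyEquiv Y' (Metric.sphere (0 : EuclideanSpace ℝ (Fin (N + 1))) 1)) (hN : 2 ≤ N) :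
    Module.finrank ℤ (singularCohomology ℤ ℤ Y N) = 1 ∧
      Module.Finite ℤ (singularCohomology ℤ ℤ Y N) :=
  finrank_eq_one_and_finite_of_iso
    ((singularCohomology.mapIso ℤ ℤ e N).symm ≪≫ (singularCohomology.isoOfHomotopyEquiv' ℤ ℤ h N).symm)
    (finrank_singularCohomology_sphere_top hN)

/-- **A clopen piece carrying all the cohomology**: `T`, `N` disjoint open, `Hʲ(N; ℤ) = 0`,
`j ≠ 0` ⇒ restriction `Hʲ(T ∪ N; ℤ) ≅ Hʲ(T; ℤ)` (Mayer–Vietoris, Hatcher §3.1 pp. 203–204).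
[cite: HatcherAT2002, §3.1 pp. 203–204] -/
theorem nonempty_singularCohomology_union_linearEquiv {Y : Type} [TopologicalSpace Y]
    {T N : Set Y} (hT : IsOpen T) (hN : IsOpen N) (hTN : T ∩ N = ∅) {j : ℕ} (hj : j ≠ 0)
    (hN0 : IsZero (singularCohomology ℤ ℤ ↥N j)) :
    Nonempty (singularCohomology ℤ ℤ ↥(T ∪ N) j ≃ₗ[ℤ] singularCohomology ℤ ℤ ↥T j) := by
  obtain ⟨p, rfl⟩ : ∃ p, j = p + 1 := ⟨j - 1, by omega⟩
  set A : Set ↥(T ∪ N) := Subtype.val ⁻¹' T with hA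
  set B : Set ↥(T ∪ N) := Subtype.val ⁻¹' N with hB
  have hAo : IsOpen A := hT.preimage continuous_subtype_val
  have hBo : IsOpen B := hN.preimage continuous_subtype_val
  have hAB : A ∪ B = univ := by
    ext y; simp only [mem_union, mem_univ, iff_true]; exact y.2
  have hABe : A ∩ B = ∅ := by
    ext y; simp only [mem_inter_iff, mem_empty_iff_false, iff_false, not_and]
    intro h1 h2
    have : (y : Y) ∈ T ∩ N := ⟨h1, h2⟩
    rw [hTN] at this; exact this
  have eA : ↥T ≃ₜ ↥A := Homeomorph.setSubtypeOfSubset subset_union_left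
  have eB : ↥N ≃ₜ ↥B := Homeomorph.setSubtypeOfSubset subset_union_right
  have hB0 : IsZero (singularCohomology ℤ ℤ ↥B (p + 1)) :=
    hN0.of_iso (singularCohomology.mapIso ℤ ℤ eB (p + 1))
  have hinj := map_subsetIncl_injective_of_clopen hAo hBo hAB hABe hB0
  have hsurj : Surjective (singularCohomology.map ℤ ℤ (subsetIncl A) (p + 1)) := fun a => by
    obtain ⟨c, hc, -⟩ := exists_map_subsetIncl_eq_of_clopen hAo hBo hAB hABe a
    exact ⟨c, hc⟩
  exact ⟨(LinearEquiv.ofBijective (singularCohomology.map ℤ ℤ (subsetIncl A) (p + 1)).hom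
    ⟨hinj, hsurj⟩).trans (singularCohomology.mapIso ℤ ℤ eA (p + 1)).toLinearEquiv⟩

namespace NullCobordism

variable {m : ℕ}
variable {M : Type} [TopologicalSpace M] [ChartedSpace (EuclideanSpace ℝ (Fin (m + 1))) M]
  [IsManifold (𝓡 (m + 1)) ∞ M]
  (c : NullCobordism (m + 1) M) {ι : Type} [Unique ι] {k l : ℕ}
  (ν : FramedSphereFamily (𝓡∂ (m + 1 + 1)) c.W ι k (l + 1)) (hkl : k + l = m + 1)
  (κ : c.boundaryData.Collar)

include hkl in
/-- **`rank Hᵏ(T̂ ⊔ N_ε; ℤ) = 1`**, finitely generated, for `2 ≤ k`: the end of `Ŵ` off `ι_X K₀`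
is the open tube `T̂ ≃ Sᵏ × Bˡ⁺¹ ≃ₕ Sᵏ` plus a contractible cone neighbourhood.
[cite: KervaireMilnorAnnals1963, §5 (Lemma 5.6)] [cite: HatcherAT2002, Cor. 2.14 and §3.1 pp. 203–204] -/
theorem finrank_singularCohomology_endsX [CompactSpace M] [Nonempty M] {ε : ℝ} (hε0 : 0 < ε)
    (hε1 : ε ≤ 1) (hthin : Disjoint (c.collarBelow κ ε) (c.closedUnitTube ν)) (hk : 2 ≤ k) :
    Module.finrank ℤ (singularCohomology ℤ ℤ ↥(c.tubeHat ν ∪ c.coneNhd κ ε) k) = 1 ∧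
      Module.Finite ℤ (singularCohomology ℤ ℤ ↥(c.tubeHat ν ∪ c.coneNhd κ ε) k) := by
  obtain ⟨e⟩ := nonempty_singularCohomology_union_linearEquiv (j := k) (c.isOpen_tubeHat ν hkl)
    (c.isOpen_coneNhd κ hε0 hε1) (c.tubeHat_inter_coneNhd_eq_empty ν hkl κ hthin) (by omega)
    (c.isZero_singularCohomology_coneNhd' κ hε1 (by omega))
  obtain ⟨e'⟩ := c.nonempty_tubeHat_homeomorph ν hkl
  obtain ⟨h1, h2⟩ := finrank_singularCohomology_of_homeomorph_homotopyEquiv_sphere_top e'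
    (modelTubeHomotopyEquiv k l) hk
  haveI := h2
  exact ⟨e.finrank_eq.trans h1, Module.Finite.equiv e.symm⟩

/-- **`rank Hˡ(T̂' ⊔ N'_ε; ℤ) = 1`**, finitely generated, for `2 ≤ l`: the end of `χ̂` off
`ι_P K₀` is `T̂' ≃ Bᵏ⁺¹ × Sˡ ≃ₕ Sˡ` plus a contractible piece.
[cite: KervaireMilnorAnnals1963, §5 (Lemma 5.6)] [cite: HatcherAT2002, Cor. 2.14 and §3.1 pp. 203–204] -/
theorem finrank_singularCohomology_endsP [CompactSpace M] [Nonempty M] [T2Space M] {ε : ℝ}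
    (hε0 : 0 < ε) (hε1 : ε ≤ 1) (hthin : Disjoint (c.collarBelow κ ε) (c.closedUnitTube ν))
    (hl : 2 ≤ l) :
    Module.finrank ℤ (singularCohomology ℤ ℤ ↥(c.handleHat ν hkl ∪ c.coneP ν hkl κ ε) l) = 1 ∧
      Module.Finite ℤ (singularCohomology ℤ ℤ ↥(c.handleHat ν hkl ∪ c.coneP ν hkl κ ε) l) := by
  obtain ⟨e⟩ := nonempty_singularCohomology_union_linearEquiv (j := l) (c.isOpen_handleHat ν hkl)
    (c.isOpen_coneP ν hkl κ hε0 hε1) (c.handleHat_inter_coneP_eq_empty ν hkl κ hthin) (by omega)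
    (c.isZero_singularCohomology_coneP ν hkl κ hε1 hthin (by omega))
  obtain ⟨e'⟩ := c.nonempty_handleHat_homeomorph ν hkl
  obtain ⟨h1, h2⟩ := finrank_singularCohomology_of_homeomorph_homotopyEquiv_sphere_top e'
    (ballProdSphereHomotopyEquiv k l) hl
  haveI := h2
  exact ⟨e.finrank_eq.trans h1, Module.Finite.equiv e.symm⟩

end NullCobordism

end Ends

/-! ### §3 Rank bookkeeping along the exact sequences of the pairs -/

section Bookkeeping

/-- `f` is onto if `X₁ ⟶ X₂ ⟶ X₃` is exact with `X₃ = 0`. [folklore] -/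
theorem surjective_of_exact_of_isZero {A B C : ModuleCat.{0} ℤ} {f : A ⟶ B} {g : B ⟶ C}
    {w : f ≫ g = 0} (h : (ShortComplex.mk f g w).Exact) (hC : IsZero C) : Surjective f := by
  rw [← ModuleCat.epi_iff_surjective]
  exact h.epi_f (hC.eq_of_tgt _ _)

/-- `g` is into if `X₁ ⟶ X₂ ⟶ X₃` is exact with `X₁ = 0`. [folklore] -/
theorem injective_of_exact_of_isZero {A B C : ModuleCat.{0} ℤ} {f : A ⟶ B} {g : B ⟶ C}
    {w : f ≫ g = 0} (h : (ShortComplex.mk f g w).Exact) (hA : IsZero A) : Injective g := by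
  rw [← ModuleCat.mono_iff_injective]
  exact h.mono_g (hA.eq_of_src _ _)

/-- A bijective morphism of `ℤ`-modules preserves the rank. [folklore] -/
theorem finrank_eq_of_bijective {A B : ModuleCat.{0} ℤ} (f : A ⟶ B) (hf : Bijective f) :
    Module.finrank ℤ A = Module.finrank ℤ B :=
  LinearEquiv.finrank_eq (LinearEquiv.ofBijective f.hom hf)

/-- **Rank bookkeeping, left model** (`F₁ ↪ H₁ → A₁ → F₂ ↠ H₂` exact, `t₁` into, `t₂` onto):
`rank H₁ + rank F₂ = rank F₁ + rank A₁ + rank H₂` and `rank F₂ ≤ rank A₁ + rank H₂`. [folklore] -/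
theorem finrank_bookkeeping_X {F₁ H₁ A₁ F₂ H₂ : ModuleCat.{0} ℤ}
    {t₁ : F₁ ⟶ H₁} {r₁ : H₁ ⟶ A₁} {δ₁ : A₁ ⟶ F₂} {t₂ : F₂ ⟶ H₂}
    (ht₁ : Injective t₁)
    {w₁ : t₁ ≫ r₁ = 0} (h₁ : (ShortComplex.mk t₁ r₁ w₁).Exact)
    {w₂ : r₁ ≫ δ₁ = 0} (h₂ : (ShortComplex.mk r₁ δ₁ w₂).Exact)
    {w₃ : δ₁ ≫ t₂ = 0} (h₃ : (ShortComplex.mk δ₁ t₂ w₃).Exact)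
    (ht₂ : Surjective t₂)
    [Module.Finite ℤ H₁] [Module.Finite ℤ A₁] [Module.Finite ℤ H₂] :
    Module.finrank ℤ H₁ + Module.finrank ℤ F₂ =
        Module.finrank ℤ F₁ + Module.finrank ℤ A₁ + Module.finrank ℤ H₂ ∧
      Module.finrank ℤ F₂ ≤ Module.finrank ℤ A₁ + Module.finrank ℤ H₂ := by
  haveI : Module.Finite ℤ F₂ := h₃.moduleCat_finite_X₂
  haveI : Epi t₂ := (ModuleCat.epi_iff_surjective t₂).2 ht₂
  have e1 := h₁.finrank_X₂_eq
  have e2 := h₂.finrank_X₂_eq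
  have e3 := h₃.finrank_X₂_eq
  have e4 := LinearMap.finrank_range_of_inj (f := t₁.hom) ht₁
  have e5 := finrank_range_of_epi t₂
  dsimp only at e1 e2 e3
  omega

/-- **Rank bookkeeping, right model** (`F₂ ↪ H₂ → A₂ → F₃ ↠ H₃` exact, `t₂` into, `t₃` onto):
`rank H₂ + rank F₃ = rank F₂ + rank A₂ + rank H₃`. [folklore] -/
theorem finrank_bookkeeping_P {F₂ H₂ A₂ F₃ H₃ : ModuleCat.{0} ℤ}
    {t₂ : F₂ ⟶ H₂} {r₂ : H₂ ⟶ A₂} {δ₂ : A₂ ⟶ F₃} {t₃ : F₃ ⟶ H₃}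
    (ht₂ : Injective t₂)
    {w₁ : t₂ ≫ r₂ = 0} (h₁ : (ShortComplex.mk t₂ r₂ w₁).Exact)
    {w₂ : r₂ ≫ δ₂ = 0} (h₂ : (ShortComplex.mk r₂ δ₂ w₂).Exact)
    {w₃ : δ₂ ≫ t₃ = 0} (h₃ : (ShortComplex.mk δ₂ t₃ w₃).Exact)
    (ht₃ : Surjective t₃)
    [Module.Finite ℤ H₂] [Module.Finite ℤ A₂] [Module.Finite ℤ H₃] :
    Module.finrank ℤ H₂ + Module.finrank ℤ F₃ =
      Module.finrank ℤ F₂ + Module.finrank ℤ A₂ + Module.finrank ℤ H₃ := by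
  haveI : Module.Finite ℤ F₃ := h₃.moduleCat_finite_X₂
  haveI : Epi t₃ := (ModuleCat.epi_iff_surjective t₃).2 ht₃
  have e1 := h₁.finrank_X₂_eq
  have e2 := h₂.finrank_X₂_eq
  have e3 := h₃.finrank_X₂_eq
  have e4 := LinearMap.finrank_range_of_inj (f := t₂.hom) ht₂
  have e5 := finrank_range_of_epi t₃
  dsimp only at e1 e2 e3
  omega

end Bookkeeping

/-! ### §4 The signature is unchanged (spheres of dimension `k = p - 1`) -/

namespace NullCobordism

variable {m : ℕ} (S : HomotopySphere (m + 1))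
  (c : NullCobordism (m + 1) S.carrier) {ι : Type} [Unique ι] {k l : ℕ}
  (ν : FramedSphereFamily (𝓡∂ (m + 1 + 1)) c.W ι k (l + 1)) (hkl : k + l = m + 1)

/-- **The signature is not changed by a surgery on a `(p-1)`-sphere in a `(p + p)`-manifold
bounded by a homotopy sphere, `4 ≤ p` even** (Kosinski 1993, X Prop. (3.3), p. 206: "`σ(M)` is
an invariant of cobordism"; Kervaire–Milnor 1963, §5–§7 with footnote pp. 528–529): given
`(Σ, μ) = bW` (`c.IsOrientedBy μ μ'`) there is an orientation `μ''` of the closed model of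
`χ = χ(W, φ)` with `(Σ, μ) = bχ` and `σ(χ̂, μ'') = σ(Ŵ, μ')`.  Proof: with the thin collar and
the compact `K₀ ⊆ U`, the cup product pairings `BX`, `BP` of `Ŵ`, `χ̂` pull back to ONE form on
`F = Hᵖ(Z, Z ∖ K₀)` along `g = j^* ∘ π^*` (onto `Hᵖ(Ŵ)`) and `f = j'^* ∘ π'^*` (into `Hᵖ(χ̂)`);
the ends contribute `Hᵖ⁻¹(Ŵ ∖ ι_X K₀) ≅ ℤ ≅ Hᵖ(χ̂ ∖ ι_P K₀)`, whence (exact sequences of the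
pairs, `rank Hᵖ⁻¹ = rank Hᵖ⁺¹` on both closed models by Lefschetz duality of `(W, bW)` and
`(χ, bχ)`) `rank coker f = rank ker j^* ≤ 1`, and the algebraic dispatcher
`signature_compl₁₂_eq_of_corank_le_one` (unimodularity of `χ̂` modulo torsion,
`isUnimodular_intersectionForm_closedModel`) gives `τ(f^* BP) = τ(BP)`.
[cite: Kosinski1993, Ch. X §3, Prop. (3.3), p. 206] [cite: KervaireMilnorAnnals1963, §5 and §7, p. 528 with footnote pp. 528–529] -/
theorem signatureInDim_surgery_eq_of_eq {p : ℕ} (hp : p + p = m + 1 + 1) (h4p : 4 ≤ p)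
    (hpe : Even p) (hkp : k + 1 = p)
    {μ : HomologicalOrientation ℤ S.carrier (m + 1)}
    {μ' : HomologicalOrientation ℤ (ClosedModel (m + 1) c.W) (m + 1 + 1)}
    (hob : c.IsOrientedBy μ μ') :
    ∃ μ'' : HomologicalOrientation ℤ (ClosedModel (m + 1) (c.surgery ν hkl).W) (m + 1 + 1),
      (c.surgery ν hkl).IsOrientedBy μ μ'' ∧ μ''.signatureInDim hp = μ'.signatureInDim hp := by
  haveI : Nonempty S.carrier := S.nonempty
  haveI : ConnectedSpace S.carrier := S.connectedSpace (Nat.succ_ne_zero m)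
  -- normalise the indices: `p = q + 2`, `k = q + 1`, `l = q + 2`
  obtain ⟨q, rfl⟩ : ∃ q, p = q + 2 := ⟨p - 2, by omega⟩
  obtain rfl : k = q + 1 := by omega
  obtain rfl : l = q + 2 := by omega
  obtain ⟨w, w', μ'', -, -, hμ', hμ'', hob', hloc⟩ :=
    c.exists_isOrientedBy_surgery_local ν hkl (by omega) (by omega) hob
  refine ⟨μ'', hob', ?_⟩
  -- a collar of `W` and a thin level off the closed tube; the compact `K₀ ⊆ U`
  obtain ⟨κ⟩ := BoundaryData.nonempty_collar_of_compactSpace m c.W c.boundaryData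
  obtain ⟨ε, hε0, hε1, hthin⟩ := c.exists_collarBelow_disjoint κ (c.isCompact_closedUnitTube ν)
    (c.closedUnitTube_subset_interior ν hkl)
  have hK : IsCompact (c.K₀U ν κ ε) := c.isCompact_K₀U ν κ hε0 hε1
  -- the ends: vanishing off the critical degree, rank one in the critical degree
  have hAX : ∀ j, 2 ≤ j → j ≠ q + 1 →
      IsZero (singularCohomology ℤ ℤ ↥(c.ιX ν hkl '' c.K₀U ν κ ε)ᶜ j) := fun j hj hjk => by
    rw [c.compl_image_ιX_K₀U ν hkl κ hε0]
    exact c.isZero_singularCohomology_endsX ν hkl κ hε0 hε1 hthin hj hjk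
  have hAP : ∀ j, 2 ≤ j → j ≠ q + 2 →
      IsZero (singularCohomology ℤ ℤ ↥(c.ιP ν hkl '' c.K₀U ν κ ε)ᶜ j) := fun j hj hjl => by
    rw [c.compl_image_ιP_K₀U ν hkl κ hε0]
    exact c.isZero_singularCohomology_endsP ν hkl κ hε0 hε1 hthin hj hjl
  have hAX1 : Module.finrank ℤ (singularCohomology ℤ ℤ ↥(c.ιX ν hkl '' c.K₀U ν κ ε)ᶜ (q + 1)) = 1 ∧
      Module.Finite ℤ (singularCohomology ℤ ℤ ↥(c.ιX ν hkl '' c.K₀U ν κ ε)ᶜ (q + 1)) := by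
    rw [c.compl_image_ιX_K₀U ν hkl κ hε0]
    exact c.finrank_singularCohomology_endsX ν hkl κ hε0 hε1 hthin (by omega)
  have hAP1 : Module.finrank ℤ (singularCohomology ℤ ℤ ↥(c.ιP ν hkl '' c.K₀U ν κ ε)ᶜ (q + 2)) = 1 ∧
      Module.Finite ℤ (singularCohomology ℤ ℤ ↥(c.ιP ν hkl '' c.K₀U ν κ ε)ᶜ (q + 2)) := by
    rw [c.compl_image_ιP_K₀U ν hkl κ hε0]
    exact c.finrank_singularCohomology_endsP ν hkl κ hε0 hε1 hthin (by omega)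
  haveI := hAX1.2
  haveI := hAP1.2
  -- names for the two complements
  set AX : Set (ClosedModel (m + 1) c.W) := (c.ιX ν hkl '' c.K₀U ν κ ε)ᶜ with hAXdef
  set AP : Set (ClosedModel (m + 1) (c.surgery ν hkl).W) := (c.ιP ν hkl '' c.K₀U ν κ ε)ᶜ with hAPdef
  -- the four maps in the middle degree
  set tX := (relSingularCohomology.toAbsolute ℤ ℤ (ClosedModel (m + 1) c.W) AX (q + 2)).hom
    with htXdef
  set tP := (relSingularCohomology.toAbsolute ℤ ℤ (ClosedModel (m + 1) (c.surgery ν hkl).W) AP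
    (q + 2)).hom with htPdef
  set πX := (relSingularCohomology.map ℤ ℤ (c.collapseX ν hkl)
    (c.mapsTo_collapseX ν hkl (c.K₀U ν κ ε)) (q + 2)).hom with hπXdef
  set πP := (relSingularCohomology.map ℤ ℤ (c.collapseP ν hkl)
    (c.mapsTo_collapseP ν hkl (c.K₀U ν κ ε)) (q + 2)).hom with hπPdef
  have htX : Surjective tX := c.surjective_toAbsolute_X ν hkl κ hε0 hε1 hthin (by omega) (by omega)
  have htPi : Injective tP := c.injective_toAbsolute_P ν hkl κ hε0 hε1 hthin (by omega) (by omega)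
  have hπX : Bijective πX := c.bijective_relMap_collapseX ν hkl hK (q + 2)
  have hπP : Bijective πP := c.bijective_relMap_collapseP ν hkl hK (q + 2)
  -- finiteness of the modules
  obtain ⟨κP⟩ := BoundaryData.nonempty_collar_of_compactSpace m (c.surgery ν hkl).W
    (c.surgery ν hkl).boundaryData
  haveI := fun j => c.finite_singularHomology_closedModel κ j
  haveI := fun j => (c.surgery ν hkl).finite_singularHomology_closedModel κP j
  haveI finX : ∀ j, Module.Finite ℤ (singularCohomology ℤ ℤ (ClosedModel (m + 1) c.W) j) := fun j =>
    finite_singularCohomology_of_finite_singularHomology j fun j _ => inferInstance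
  haveI finP : ∀ j, Module.Finite ℤ (singularCohomology ℤ ℤ (ClosedModel (m + 1) (c.surgery ν hkl).W) j) :=
    fun j => finite_singularCohomology_of_finite_singularHomology j fun j _ => inferInstance
  haveI := finX (q + 1)
  haveI := finX (q + 2)
  haveI := finX (q + 3)
  haveI := finP (q + 1)
  haveI := finP (q + 2)
  haveI := finP (q + 3)
  haveI : Module.Finite ℤ (freeCohomology ℤ (ClosedModel (m + 1) c.W) (q + 2)) :=
    c.finite_freeCohomology_closedModel κ (q + 2)
  haveI : Module.Finite ℤ (freeCohomology ℤ (ClosedModel (m + 1) (c.surgery ν hkl).W) (q + 2)) :=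
    (c.surgery ν hkl).finite_freeCohomology_closedModel κP (q + 2)
  haveI finFP : Module.Finite ℤ (relSingularCohomology ℤ ℤ (ClosedModel (m + 1) (c.surgery ν hkl).W)
      AP (q + 2)) := Module.Finite.of_injective tP htPi
  haveI finFZ : Module.Finite ℤ (relSingularCohomology ℤ ℤ (c.collapseTarget ν)
      ((c.ιZ ν '' c.K₀U ν κ ε)ᶜ) (q + 2)) := Module.Finite.of_injective πP hπP.1
  haveI finFX : Module.Finite ℤ (relSingularCohomology ℤ ℤ (ClosedModel (m + 1) c.W)
      AX (q + 2)) := Module.Finite.of_surjective πX hπX.2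
  -- §§ rank bookkeeping: left model
  have EX := finrank_bookkeeping_X
    (F₁ := relSingularCohomology ℤ ℤ (ClosedModel (m + 1) c.W) AX (q + 1))
    (injective_of_exact_of_isZero
      (relSingularCohomology.exact_δ_toAbsolute (R := ℤ) (M := ℤ) (X := ClosedModel (m + 1) c.W)
        AX q (q + 1) rfl) (hAX q (by omega) (by omega)))
    (relSingularCohomology.exact_toAbsolute_map (R := ℤ) (M := ℤ) (X := ClosedModel (m + 1) c.W)
      AX (q + 1))
    (relSingularCohomology.exact_map_δ (R := ℤ) (M := ℤ) (X := ClosedModel (m + 1) c.W)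
      AX (q + 1) (q + 2) rfl)
    (relSingularCohomology.exact_δ_toAbsolute (R := ℤ) (M := ℤ) (X := ClosedModel (m + 1) c.W)
      AX (q + 1) (q + 2) rfl) htX
  have EX' : Module.finrank ℤ (relSingularCohomology ℤ ℤ (ClosedModel (m + 1) c.W) AX (q + 3)) =
      Module.finrank ℤ (singularCohomology ℤ ℤ (ClosedModel (m + 1) c.W) (q + 3)) :=
    finrank_eq_of_bijective _
      ⟨injective_of_exact_of_isZero
        (relSingularCohomology.exact_δ_toAbsolute (R := ℤ) (M := ℤ) (X := ClosedModel (m + 1) c.W)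
          AX (q + 2) (q + 3) rfl) (hAX (q + 2) (by omega) (by omega)),
       surjective_of_exact_of_isZero
        (relSingularCohomology.exact_toAbsolute_map (R := ℤ) (M := ℤ) (X := ClosedModel (m + 1) c.W)
          AX (q + 3)) (hAX (q + 3) (by omega) (by omega))⟩
  have SX : Module.finrank ℤ (singularCohomology ℤ ℤ (ClosedModel (m + 1) c.W) (q + 1)) =
      Module.finrank ℤ (singularCohomology ℤ ℤ (ClosedModel (m + 1) c.W) (q + 3)) :=
    S.finrank_singularCohomology_closedModel_symm c hob (p := q + 1) (by omega) (by omega)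
  -- §§ rank bookkeeping: right model
  have EP' : Module.finrank ℤ (relSingularCohomology ℤ ℤ (ClosedModel (m + 1) (c.surgery ν hkl).W)
      AP (q + 1)) =
      Module.finrank ℤ (singularCohomology ℤ ℤ (ClosedModel (m + 1) (c.surgery ν hkl).W) (q + 1)) :=
    finrank_eq_of_bijective _
      ⟨injective_of_exact_of_isZero
        (relSingularCohomology.exact_δ_toAbsolute (R := ℤ) (M := ℤ)
          (X := ClosedModel (m + 1) (c.surgery ν hkl).W) AP q (q + 1) rfl) (hAP q (by omega) (by omega)),
       surjective_of_exact_of_isZero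
        (relSingularCohomology.exact_toAbsolute_map (R := ℤ) (M := ℤ)
          (X := ClosedModel (m + 1) (c.surgery ν hkl).W) AP (q + 1)) (hAP (q + 1) (by omega) (by omega))⟩
  have EP := finrank_bookkeeping_P htPi
    (relSingularCohomology.exact_toAbsolute_map (R := ℤ) (M := ℤ)
      (X := ClosedModel (m + 1) (c.surgery ν hkl).W) AP (q + 2))
    (relSingularCohomology.exact_map_δ (R := ℤ) (M := ℤ)
      (X := ClosedModel (m + 1) (c.surgery ν hkl).W) AP (q + 2) (q + 3) rfl)
    (relSingularCohomology.exact_δ_toAbsolute (R := ℤ) (M := ℤ)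
      (X := ClosedModel (m + 1) (c.surgery ν hkl).W) AP (q + 2) (q + 3) rfl)
    (surjective_of_exact_of_isZero
      (relSingularCohomology.exact_toAbsolute_map (R := ℤ) (M := ℤ)
        (X := ClosedModel (m + 1) (c.surgery ν hkl).W) AP (q + 3)) (hAP (q + 3) (by omega) (by omega)))
  have SP : Module.finrank ℤ (singularCohomology ℤ ℤ (ClosedModel (m + 1) (c.surgery ν hkl).W) (q + 1)) =
      Module.finrank ℤ (singularCohomology ℤ ℤ (ClosedModel (m + 1) (c.surgery ν hkl).W) (q + 3)) :=
    S.finrank_singularCohomology_closedModel_symm (c.surgery ν hkl) hob' (p := q + 1)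
      (by omega) (by omega)
  -- §§ the relative groups of the two models agree (through `Z`)
  have CZ1 : Module.finrank ℤ (relSingularCohomology ℤ ℤ (ClosedModel (m + 1) c.W) AX (q + 1)) =
      Module.finrank ℤ (relSingularCohomology ℤ ℤ (ClosedModel (m + 1) (c.surgery ν hkl).W)
        AP (q + 1)) :=
    (finrank_eq_of_bijective _ (c.bijective_relMap_collapseX ν hkl hK (q + 1))).symm.trans
      (finrank_eq_of_bijective _ (c.bijective_relMap_collapseP ν hkl hK (q + 1)))
  have CZ3 : Module.finrank ℤ (relSingularCohomology ℤ ℤ (ClosedModel (m + 1) c.W) AX (q + 3)) =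
      Module.finrank ℤ (relSingularCohomology ℤ ℤ (ClosedModel (m + 1) (c.surgery ν hkl).W)
        AP (q + 3)) :=
    (finrank_eq_of_bijective _ (c.bijective_relMap_collapseX ν hkl hK (q + 3))).symm.trans
      (finrank_eq_of_bijective _ (c.bijective_relMap_collapseP ν hkl hK (q + 3)))
  have CZ2X : Module.finrank ℤ (relSingularCohomology ℤ ℤ (c.collapseTarget ν)
      ((c.ιZ ν '' c.K₀U ν κ ε)ᶜ) (q + 2)) =
      Module.finrank ℤ (relSingularCohomology ℤ ℤ (ClosedModel (m + 1) c.W) AX (q + 2)) :=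
    finrank_eq_of_bijective _ hπX
  have CZ2P : Module.finrank ℤ (relSingularCohomology ℤ ℤ (c.collapseTarget ν)
      ((c.ιZ ν '' c.K₀U ν κ ε)ᶜ) (q + 2)) =
      Module.finrank ℤ (relSingularCohomology ℤ ℤ (ClosedModel (m + 1) (c.surgery ν hkl).W)
        AP (q + 2)) :=
    finrank_eq_of_bijective _ hπP
  -- hence `rank coker(tP) = rank ker(tX) ≤ 1`, in the form the dispatcher wants
  have hrank1 : Module.finrank ℤ (singularCohomology ℤ ℤ (ClosedModel (m + 1) (c.surgery ν hkl).W) (q + 2)) +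
      Module.finrank ℤ (singularCohomology ℤ ℤ (ClosedModel (m + 1) c.W) (q + 2)) =
      Module.finrank ℤ (relSingularCohomology ℤ ℤ (c.collapseTarget ν)
        ((c.ιZ ν '' c.K₀U ν κ ε)ᶜ) (q + 2)) +
      Module.finrank ℤ (relSingularCohomology ℤ ℤ (c.collapseTarget ν)
        ((c.ιZ ν '' c.K₀U ν κ ε)ᶜ) (q + 2)) := by
    obtain ⟨EX1, EX2⟩ := EX
    omega
  have hrank2 : Module.finrank ℤ (relSingularCohomology ℤ ℤ (c.collapseTarget ν)
        ((c.ιZ ν '' c.K₀U ν κ ε)ᶜ) (q + 2)) ≤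
      Module.finrank ℤ (singularCohomology ℤ ℤ (ClosedModel (m + 1) c.W) (q + 2)) + 1 := by
    obtain ⟨EX1, EX2⟩ := EX
    omega
  -- the forms
  set BX : LinearMap.BilinForm ℤ (singularCohomology ℤ ℤ (ClosedModel (m + 1) c.W) (q + 2)) :=
    cupPairing μ' hp with hBX
  set BP : LinearMap.BilinForm ℤ (singularCohomology ℤ ℤ (ClosedModel (m + 1) (c.surgery ν hkl).W) (q + 2)) :=
    cupPairing μ'' hp with hBP
  have hagree : ∀ a b, BX ((tX ∘ₗ πX) a) ((tX ∘ₗ πX) b) = BP ((tP ∘ₗ πP) a) ((tP ∘ₗ πP) b) := by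
    intro a b
    rw [LinearMap.comp_apply, LinearMap.comp_apply, LinearMap.comp_apply, LinearMap.comp_apply,
      hBX, hBP, htXdef, hπXdef, htPdef, hπPdef]
    refine (c.cupPairing_toAbsolute_relMap_collapseX ν hkl hp μ' _ a b).trans
      (Eq.trans ?_ (c.cupPairing_toAbsolute_relMap_collapseP ν hkl hp μ'' _ a b).symm)
    exact kroneckerPairing_cupProduct_map_collapse_eq hμ' hμ'' hloc hK hp _ _
      (relSingularCohomology.map_subsetIncl_toAbsolute _ (q + 2) a)
  -- `BP` is symmetric (`p` even)
  have hflip : BP.flip = BP := by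
    have h := cupPairing_flip (cupProduct_gradedComm_holds ℤ _) μ'' hp hp
    rwa [Even.neg_one_pow (hpe.mul_right (q + 2)), one_smul] at h
  have hBPs : BP.IsSymm := LinearMap.BilinForm.isSymm_def.2 fun x y =>
    LinearMap.congr_fun (LinearMap.congr_fun hflip y) x
  -- `BP` is non-degenerate modulo torsion (unimodularity of `χ̂`)
  have hfc : ∃ z, IsFundamentalClass μ'' z :=
    ⟨_, hob'.isFundamentalClass_fundamentalClass (c.surgery ν hkl) (by omega)⟩
  obtain ⟨hu, -⟩ := S.isUnimodular_intersectionForm_closedModel (c.surgery ν hkl) hob' hfc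
    (p := q + 2) (by omega) hp
  have hnd : ∀ u : singularCohomology ℤ ℤ (ClosedModel (m + 1) (c.surgery ν hkl).W) (q + 2),
      (∀ v, BP u v = 0) → ∃ n : ℤ, n ≠ 0 ∧ n • u = 0 := by
    intro u hu0
    have h1 : intersectionForm hp μ'' (freeCohomology.mk u) = 0 := by
      refine LinearMap.ext fun y => ?_
      induction y using freeCohomology.induction_on with
      | h b => rw [intersectionForm_mk_mk, LinearMap.zero_apply, ← hBP]; exact hu0 b
    haveI : (intersectionForm hp μ'').IsPerfPair := hu
    have h2 : freeCohomology.mk u = 0 :=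
      (LinearMap.IsPerfPair.bijective_left (intersectionForm hp μ'')).1 (by rw [h1, map_zero])
    obtain ⟨a, ha⟩ := (Submodule.mem_torsion_iff u).1 ((freeCohomology.mk_eq_zero_iff u).1 h2)
    exact ⟨a, nonZeroDivisors.coe_ne_zero a,
      (int_smul_eq_zsmul (ModuleCat.isModule _) (a : ℤ) u).symm.trans ha⟩
  -- the chain of indices
  have e1 : μ'.signatureInDim hp = BX.signature := by
    rw [HomologicalOrientation.signatureInDim_def]
    exact (LinearMap.BilinForm.signature_eq_of_comp_surjective BX (intersectionForm hp μ')
      freeCohomology.mk (fun x y => intersectionForm_mk_mk hp μ' x y) freeCohomology.mk_surjective).symm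
  have e2 : LinearMap.BilinForm.signature (BX.compl₁₂ (tX ∘ₗ πX) (tX ∘ₗ πX)) = BX.signature :=
    LinearMap.BilinForm.signature_eq_of_comp_surjective _ BX (tX ∘ₗ πX) (fun x y => rfl)
      (htX.comp hπX.2)
  have e3 : μ''.signatureInDim hp = BP.signature := by
    rw [HomologicalOrientation.signatureInDim_def]
    exact (LinearMap.BilinForm.signature_eq_of_comp_surjective BP (intersectionForm hp μ'')
      freeCohomology.mk (fun x y => intersectionForm_mk_mk hp μ'' x y) freeCohomology.mk_surjective).symm
  have e4 : LinearMap.BilinForm.signature (BP.compl₁₂ (tP ∘ₗ πP) (tP ∘ₗ πP)) = BP.signature :=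
    LinearMap.BilinForm.signature_compl₁₂_eq_of_corank_le_one BX BP hBPs (tX ∘ₗ πX)
      (htX.comp hπX.2) (tP ∘ₗ πP) (htPi.comp hπP.1) hagree hnd hrank1 hrank2
  have e5 : BX.compl₁₂ (tX ∘ₗ πX) (tX ∘ₗ πX) = BP.compl₁₂ (tP ∘ₗ πP) (tP ∘ₗ πP) := by
    refine LinearMap.ext fun a => LinearMap.ext fun b => ?_
    exact hagree a b
  rw [e1, e3, ← e2, ← e4, e5]

end NullCobordism

end Literature.Topology.FourManifolds
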